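import Summits.QuantumAdvantage.QuantumAdvantage.Theorems.CubicForrelationNearExactIsExactTwelveLevelFiveAlphaEta

/-!
# Crux `CubicForrelation.NearExactIsExact` (stmt-QuantumAdvantage-14043) — n = 12, open window, a LEVEL-5 side in CASE α: the TWISTED SIGN BIT
  `hb' = hb ⊕ 1_{A₂}(· ⊕ t₀)` is relatively quadratic on `P`, and `8 ∣ Σ e₅` over every 4-flat of `P` with two directions in `V₁`

Certificate seat `b2b-cforr-cert` (gen 30).  HONEST FRAMING: kernel-checked finite-slice lemmas (standard axioms) about cubic Boolean pairs on 12
bits; preparation for the isotropy lemma of the case-α kill.  NO value of `θ₁₂` claimed; NOT summit progress.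

Setting as in …TwelveLevelFiveAlphaEta: `W_g = 32u'`, `e = u' − 2(−1)^f`, `P = {u' odd} = x₀ ⊕ V`, complement `c ⊕ V`, `A₂ = c ⊕ V₁`
(`#V₁ = 256`), `hb = [e ≡ 3 (mod 4)]`, budget `Σ_P (e² − 1) + Σ_{off P} e² ≤ 1535`.  Fix a transversal `t₀ ∉ V` and put
`hb'(x) = hb(x) ⊕ [4 ∤ e(x ⊕ t₀)]` — on `P` the second bit is the indicator of the `V₁`-coset `K = (A₂ ⊕ t₀) ∩ P`.
* `tzi_H3`: `4 ∣ Σ_{3-flat ⊂ P} sZ ∘ hb'` (from `tzw_alpha_H3`: the 3-flat parities of `hb` and of `1_K` agree); `tzi_hsd`: hence `hb'` has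
  base-free second differences along `V` on `P` (`fr_hsd`) — the relative quadratic of PLAN-N12-WINDOW-ALPHA §A1.
* `tzi_L5_card`: at most `63` points of `P` have `8 ∤ e − σ₅` (each costs `≥ 8`).
* `tzi_zero_value`: a point off `P`, off `A₂` and outside the stray set `S_R` has `e = 0`.
* `tzi_flatPt4`: the point of the parametrised 4-flat `x ⊕ ε·(t₁, t₂, w₁, w₂)` is `(x ⊕ (ε₀t₁ ⊕ ε₁t₂)) ⊕ (ε₂w₁ ⊕ ε₃w₂)`.
* `tzi_H4w` (**(H4) for frames with two `V₁`-directions**): `8 ∣ Σ_{ε} e(x ⊕ ε·(t₁,t₂,w₁,w₂))` for `x ∈ P`, `t₁, t₂ ∈ V`, `w₁, w₂ ∈ V₁`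
  [`l5c_flat5` on the 5-flat through `x` and a CLEAN parallel translate `z ⊕ ⟨t₁,t₂,w₁,w₂⟩` off `P` on which `e` vanishes identically:
  `z` avoids the four translates `A₂ ⊕ {0, t₁, t₂, t₁ ⊕ t₂}` (`1024` points) and the `16` translates of `S_R` (`≤ 496` points)].

References: J. Ax (1964) / R. J. McEliece (1972); MacWilliams–Sloane (1977) Ch. 13 §3, Ch. 15 §2; C. Carlet (2021) §5.2.  Axioms: the standard
three.
-/

set_option linter.dupNamespace false -- D-0017: single-problem summit ⇒ `QuantumAdvantage.QuantumAdvantage` by design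

noncomputable section

namespace Summit.QuantumAdvantage.QuantumAdvantage.Theorems.CubicForrelation.NearExactIsExact

open Finset
open Literature.Computability.QuantumComplexity
open Literature.Computability.QuantumComplexity.BuzetChailloux (bxor zeroVec bxor_bxor_cancel_left bxor_zeroVec zeroVec_bxor bxor_comm
  bxor_self)
open Literature.Computability.QuantumComplexity.DerivativeWalsh (W)

/-! ### Small tools -/

/-- `#{p ⊕ q} + #{p} + #{q}` is even. [folklore] -/
theorem tzi_card_xor_even {α : Type*} (s : Finset α) (p q : α → Bool) :
    Even (#(s.filter fun x => (p x ^^ q x) = true) + #(s.filter fun x => p x = true) + #(s.filter fun x => q x = true)) := by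
  classical
  rw [card_filter, card_filter, card_filter, ← sum_add_distrib, ← sum_add_distrib]
  refine even_sum _ fun x _ => ?_
  cases p x <;> cases q x <;> decide

/-- `Σ sZ ∘ b = #s − 2·#{b}`. [folklore] -/
theorem tzi_sum_sZ {α : Type*} (s : Finset α) (b : α → Bool) :
    ∑ x ∈ s, sZ (b x) = #s - 2 * #(s.filter fun x => b x = true) := by
  classical
  have h : ∀ x ∈ s, sZ (b x) = 1 - 2 * (if b x = true then (1 : ℤ) else 0) := by
    intro x _; cases b x <;> simp [sZ]
  rw [sum_congr rfl h, sum_sub_distrib, sum_const, ← mul_sum, sum_boole, nsmul_eq_mul, mul_one]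

/-- **The point of a parametrised 4-flat, split `2 + 2`.** [folklore] -/
theorem tzi_flatPt4 {n : ℕ} (b t₁ t₂ w₁ w₂ : Fin n → Bool) (ε : Fin 4 → Bool) :
    (fun j => b j ^^ decide (Odd #(univ.filter fun i => ε i && (![t₁, t₂, w₁, w₂] : Fin 4 → Fin n → Bool) i j))) =
      bxor (bxor b (fun j => (ε 0 && t₁ j) ^^ (ε 1 && t₂ j))) (fun j => (ε 2 && w₁ j) ^^ (ε 3 && w₂ j)) := by
  rw [es_flatPt_four]
  funext j
  show (b j ^^ ((ε 0 && t₁ j) ^^ (ε 1 && t₂ j) ^^ (ε 2 && w₁ j) ^^ (ε 3 && w₂ j))) =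
    ((b j ^^ ((ε 0 && t₁ j) ^^ (ε 1 && t₂ j))) ^^ ((ε 2 && w₁ j) ^^ (ε 3 && w₂ j)))
  cases (ε 0 && t₁ j) <;> cases (ε 1 && t₂ j) <;> cases (ε 2 && w₁ j) <;> cases (ε 3 && w₂ j) <;> cases b j <;> rfl

/-- The `t`-part `ε₀t₁ ⊕ ε₁t₂` of a 4-flat point is one of `0, t₁, t₂, t₁ ⊕ t₂`. [folklore] -/
theorem tzi_tpart_cases {n : ℕ} (t₁ t₂ : Fin n → Bool) (ε : Fin 4 → Bool) :
    (fun j => (ε 0 && t₁ j) ^^ (ε 1 && t₂ j)) = zeroVec ∨ (fun j => (ε 0 && t₁ j) ^^ (ε 1 && t₂ j)) = t₁ ∨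
      (fun j => (ε 0 && t₁ j) ^^ (ε 1 && t₂ j)) = t₂ ∨ (fun j => (ε 0 && t₁ j) ^^ (ε 1 && t₂ j)) = bxor t₁ t₂ := by
  cases h0 : ε 0 <;> cases h1 : ε 1
  · left; funext j; simp [zeroVec]
  · right; right; left; funext j; simp
  · right; left; funext j; simp
  · right; right; right; funext j; simp [bxor]

/-- A combination `ε₀a ⊕ ε₁b` of two elements of an xor-closed `V₀ ∋ 0` lies in `V₀`. [folklore] -/
theorem tzi_pair_mem {n : ℕ} (V₀ : Finset (Fin n → Bool)) (h0 : zeroVec ∈ V₀) (hadd : ∀ a ∈ V₀, ∀ b ∈ V₀, bxor a b ∈ V₀)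
    {a b : Fin n → Bool} (ha : a ∈ V₀) (hb : b ∈ V₀) (e₀ e₁ : Bool) :
    (fun j => (e₀ && a j) ^^ (e₁ && b j)) ∈ V₀ :=
  hadd _ (fr_smul_mem V₀ h0 ha e₀) _ (fr_smul_mem V₀ h0 hb e₁)

/-! ### The twisted sign bit is relatively quadratic on `P` -/

/-- **(H3) for the twisted sign bit.**  Cubic `f, g`, `W_g = 32u'`, `P = {u' odd} = x₀ ⊕ V`, `t₀ ∉ V`,
`hb'(x) = [e(x) ≡ 3 (mod 4)] ⊕ [4 ∤ e(x ⊕ t₀)]`: every parametrised 3-flat sign sum of `hb'` with base in `P` and directions in `V`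
is `≡ 0 (mod 4)` (`tzw_alpha_H3`). [this work] -/
theorem tzi_H3 (f g : (Fin (6 + 6) → Bool) → Bool) (hf : IsDegLeFun 3 f) (hg : IsDegLeFun 3 g)
    (u' : (Fin (6 + 6) → Bool) → ℤ) (hu' : ∀ x, W (fun y => signOf (g y)) x = (2 : ℝ) ^ 5 * (u' x : ℝ))
    (V : Finset (Fin (6 + 6) → Bool)) (x₀ : Fin (6 + 6) → Bool) (h0 : zeroVec ∈ V) (hadd : ∀ a ∈ V, ∀ b ∈ V, bxor a b ∈ V)
    (hP : (univ.filter fun x : Fin (6 + 6) → Bool => Odd (u' x)) = V.image (bxor x₀))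
    {t₀ : Fin (6 + 6) → Bool} (ht₀ : t₀ ∉ V) :
    ∀ x, Odd (u' x) → ∀ a b d : Fin (6 + 6) → Bool, a ∈ V → b ∈ V → d ∈ V →
      (4 : ℤ) ∣ ∑ ε : Fin 3 → Bool, sZ ((fun z => decide ((u' z - 2 * sZ (f z)) % 4 = 3) ^^
        decide (¬ (4 : ℤ) ∣ u' (bxor z t₀) - 2 * sZ (f (bxor z t₀))))
        (fun j => x j ^^ decide (Odd #(univ.filter fun i => ε i && (![a, b, d] : Fin 3 → Fin (6 + 6) → Bool) i j)))) := by
  classical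
  intro x hx a b d ha hbV hd
  set hb : (Fin (6 + 6) → Bool) → Bool := fun z => decide ((u' z - 2 * sZ (f z)) % 4 = 3) with hbdef
  set hA : (Fin (6 + 6) → Bool) → Bool := fun z => decide (¬ (4 : ℤ) ∣ u' z - 2 * sZ (f z)) with hAdef
  have hpar := tzw_alpha_H3 f g hf hg u' hu' V x₀ h0 hadd hP hb (fun z => rfl) hx ha hbV hd ht₀
  set pt : (Fin 3 → Bool) → (Fin (6 + 6) → Bool) :=
    fun ε => fun j => x j ^^ decide (Odd #(univ.filter fun i => ε i && (![a, b, d] : Fin 3 → Fin (6 + 6) → Bool) i j)) with hpt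
  change Even #(univ.filter fun ε => hb (pt ε) = true) ↔
    Even #(univ.filter fun ε => ¬ (4 : ℤ) ∣ u' (bxor (pt ε) t₀) - 2 * sZ (f (bxor (pt ε) t₀))) at hpar
  have hfilt : (univ.filter fun ε => ¬ (4 : ℤ) ∣ u' (bxor (pt ε) t₀) - 2 * sZ (f (bxor (pt ε) t₀))) =
      univ.filter fun ε => hA (bxor (pt ε) t₀) = true := by
    refine filter_congr fun ε _ => ?_
    simp only [hA, decide_eq_true_eq]
  rw [hfilt] at hpar
  have hev := tzi_card_xor_even (univ : Finset (Fin 3 → Bool)) (fun ε => hb (pt ε)) (fun ε => hA (bxor (pt ε) t₀))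
  have hxe : Even #(univ.filter fun ε : Fin 3 → Bool => (hb (pt ε) ^^ hA (bxor (pt ε) t₀)) = true) := by
    rcases Nat.even_or_odd #(univ.filter fun ε : Fin 3 → Bool => hb (pt ε) = true) with h1 | h1
    · have h2 := hpar.1 h1
      have h3 : Even (#(univ.filter fun ε : Fin 3 → Bool => hb (pt ε) = true) +
          #(univ.filter fun ε : Fin 3 → Bool => hA (bxor (pt ε) t₀) = true)) := h1.add h2
      exact (Nat.even_add.1 (by simpa [add_assoc] using hev)).2 h3
    · have h2 : Odd #(univ.filter fun ε : Fin 3 → Bool => hA (bxor (pt ε) t₀) = true) := by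
        by_contra h2
        rw [Nat.not_odd_iff_even] at h2
        exact (Nat.not_even_iff_odd.2 h1) (hpar.2 h2)
      have h3 : Even (#(univ.filter fun ε : Fin 3 → Bool => hb (pt ε) = true) +
          #(univ.filter fun ε : Fin 3 → Bool => hA (bxor (pt ε) t₀) = true)) := h1.add_odd h2
      exact (Nat.even_add.1 (by simpa [add_assoc] using hev)).2 h3
  change (4 : ℤ) ∣ ∑ ε : Fin 3 → Bool, sZ (hb (pt ε) ^^ hA (bxor (pt ε) t₀))
  rw [tzi_sum_sZ]
  obtain ⟨m, hm⟩ := hxe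
  rw [hm, card_univ, Fintype.card_fun, Fintype.card_bool, Fintype.card_fin]
  exact ⟨2 - m, by push_cast; ring⟩

/-- **`hsd` for the twisted sign bit** (relative quadratic on `P`): base-free second differences along `V` (`fr_hsd`). [this work] -/
theorem tzi_hsd (f g : (Fin (6 + 6) → Bool) → Bool) (hf : IsDegLeFun 3 f) (hg : IsDegLeFun 3 g)
    (u' : (Fin (6 + 6) → Bool) → ℤ) (hu' : ∀ x, W (fun y => signOf (g y)) x = (2 : ℝ) ^ 5 * (u' x : ℝ))
    (V : Finset (Fin (6 + 6) → Bool)) (x₀ : Fin (6 + 6) → Bool) (h0 : zeroVec ∈ V) (hadd : ∀ a ∈ V, ∀ b ∈ V, bxor a b ∈ V)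
    (hP : (univ.filter fun x : Fin (6 + 6) → Bool => Odd (u' x)) = V.image (bxor x₀))
    {t₀ : Fin (6 + 6) → Bool} (ht₀ : t₀ ∉ V) :
    ∀ x, Odd (u' x) → ∀ p ∈ V, ∀ q ∈ V,
      (fun z => decide ((u' z - 2 * sZ (f z)) % 4 = 3) ^^ decide (¬ (4 : ℤ) ∣ u' (bxor z t₀) - 2 * sZ (f (bxor z t₀))))
          (bxor (bxor x p) q) =
        ((fun z => decide ((u' z - 2 * sZ (f z)) % 4 = 3) ^^ decide (¬ (4 : ℤ) ∣ u' (bxor z t₀) - 2 * sZ (f (bxor z t₀)))) x ^^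
         (fun z => decide ((u' z - 2 * sZ (f z)) % 4 = 3) ^^ decide (¬ (4 : ℤ) ∣ u' (bxor z t₀) - 2 * sZ (f (bxor z t₀)))) (bxor x p) ^^
         (fun z => decide ((u' z - 2 * sZ (f z)) % 4 = 3) ^^ decide (¬ (4 : ℤ) ∣ u' (bxor z t₀) - 2 * sZ (f (bxor z t₀)))) (bxor x q) ^^
         ((fun z => decide ((u' z - 2 * sZ (f z)) % 4 = 3) ^^ decide (¬ (4 : ℤ) ∣ u' (bxor z t₀) - 2 * sZ (f (bxor z t₀)))) x₀ ^^
          (fun z => decide ((u' z - 2 * sZ (f z)) % 4 = 3) ^^ decide (¬ (4 : ℤ) ∣ u' (bxor z t₀) - 2 * sZ (f (bxor z t₀)))) (bxor x₀ p) ^^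
          (fun z => decide ((u' z - 2 * sZ (f z)) % 4 = 3) ^^ decide (¬ (4 : ℤ) ∣ u' (bxor z t₀) - 2 * sZ (f (bxor z t₀)))) (bxor x₀ q) ^^
          (fun z => decide ((u' z - 2 * sZ (f z)) % 4 = 3) ^^ decide (¬ (4 : ℤ) ∣ u' (bxor z t₀) - 2 * sZ (f (bxor z t₀))))
            (bxor (bxor x₀ p) q))) := by
  classical
  have hx₀ : Odd (u' x₀) := by
    have : x₀ ∈ V.image (bxor x₀) := mem_image.2 ⟨zeroVec, h0, bxor_zeroVec x₀⟩
    rw [← hP] at this; exact (mem_filter.1 this).2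
  have hVP : ∀ x, Odd (u' x) → bxor x₀ x ∈ V := fun x hx => fl1_coset_diff hP (mem_filter.2 ⟨mem_univ _, hx⟩)
  exact fr_hsd V (fun z => Odd (u' z)) x₀ hx₀ hVP
    (fun z => decide ((u' z - 2 * sZ (f z)) % 4 = 3) ^^ decide (¬ (4 : ℤ) ∣ u' (bxor z t₀) - 2 * sZ (f (bxor z t₀))))
    (tzi_H3 f g hf hg u' hu' V x₀ h0 hadd hP ht₀)

/-! ### Budget: the set `L₅` is small -/

/-- **At most `63` points of `P` have `8 ∤ e − σ₅`.**  (`4 ∣ e − σ₅` on `P`; a point with `8 ∤ e − σ₅` costs `e² − 1 ≥ 8`, while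
`Σ_P (e² − 1) ≤ 1535 − Σ_{off P} e² ≤ 511` since `A₂` alone carries `≥ 1024`.) [this work] -/
theorem tzi_L5_card (f : (Fin (6 + 6) → Bool) → Bool) (u' : (Fin (6 + 6) → Bool) → ℤ)
    (c : Fin (6 + 6) → Bool) (V₁ : Finset (Fin (6 + 6) → Bool)) (h1card : #V₁ = 256)
    (hA2 : (univ.filter fun y : Fin (6 + 6) → Bool => ¬ Odd (u' y) ∧ ¬ (4 : ℤ) ∣ u' y - 2 * sZ (f y)) = V₁.image (bxor c))
    (hbud : ∑ x ∈ univ.filter (fun x : Fin (6 + 6) → Bool => Odd (u' x)), ((u' x - 2 * sZ (f x)) ^ 2 - 1) +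
        ∑ y ∈ univ.filter (fun y : Fin (6 + 6) → Bool => ¬ Odd (u' y)), (u' y - 2 * sZ (f y)) ^ 2 ≤ 1535) :
    #(univ.filter fun x : Fin (6 + 6) → Bool => Odd (u' x) ∧
      ¬ (8 : ℤ) ∣ u' x - 2 * sZ (f x) - sZ (decide ((u' x - 2 * sZ (f x)) % 4 = 3))) ≤ 63 := by
  classical
  set e : (Fin (6 + 6) → Bool) → ℤ := fun x => u' x - 2 * sZ (f x) with hedef
  set P := univ.filter (fun x : Fin (6 + 6) → Bool => Odd (u' x)) with hPdef
  set P' := univ.filter (fun y : Fin (6 + 6) → Bool => ¬ Odd (u' y)) with hP'def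
  set A₂ := univ.filter (fun y : Fin (6 + 6) → Bool => ¬ Odd (u' y) ∧ ¬ (4 : ℤ) ∣ e y) with hA₂def
  set L := univ.filter (fun x : Fin (6 + 6) → Bool => Odd (u' x) ∧ ¬ (8 : ℤ) ∣ e x - sZ (decide (e x % 4 = 3))) with hLdef
  have heodd : ∀ x ∈ P, Odd (e x) := fun x hx =>
    Int.odd_sub.2 (iff_of_true (mem_filter.1 hx).2 ⟨sZ (f x), two_mul _⟩)
  have hPnn : ∀ x ∈ P, (0 : ℤ) ≤ e x ^ 2 - 1 := by
    intro x hx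
    have h1 := Int.odd_iff.1 (heodd x hx)
    have : e x ≤ -1 ∨ 1 ≤ e x := by omega
    rcases this with h | h <;> nlinarith
  have hA2card : #A₂ = 256 := by
    rw [hA2, card_image_of_injective _ (iw_bxor_injective c), h1card]
  have hA : ∀ y ∈ A₂, (4 : ℤ) ≤ e y ^ 2 := by
    intro y hy
    obtain ⟨-, hy1, hy4⟩ := mem_filter.1 hy
    have h2 := tzb_A2_mod4 f u' hy1 hy4
    have : e y ≤ -2 ∨ 2 ≤ e y := by simp only [e]; omega
    rcases this with h | h <;> nlinarith
  have hAsub : A₂ ⊆ P' := fun y hy => mem_filter.2 ⟨mem_univ _, (mem_filter.1 hy).2.1⟩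
  have hP'ge : (1024 : ℤ) ≤ ∑ y ∈ P', e y ^ 2 := by
    have h1 : ∑ y ∈ A₂, e y ^ 2 ≤ ∑ y ∈ P', e y ^ 2 := sum_le_sum_of_subset_of_nonneg hAsub fun _ _ _ => sq_nonneg _
    have h2 := sum_le_sum hA
    rw [sum_const, hA2card, nsmul_eq_mul] at h2
    push_cast at h2
    linarith
  have hLsub : L ⊆ P := fun x hx => mem_filter.2 ⟨mem_univ _, (mem_filter.1 hx).2.1⟩
  have hLcost : ∀ x ∈ L, (8 : ℤ) ≤ e x ^ 2 - 1 := by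
    intro x hx
    obtain ⟨-, hx1, hx8⟩ := mem_filter.1 hx
    have h4 := tzl5_mod4 f u' hx1
    have hσ := tp_sZ_cases (decide (e x % 4 = 3))
    obtain ⟨k, hk⟩ := h4
    have hkodd : Odd ((e x - sZ (decide (e x % 4 = 3))) / 4) := by
      have hk' : (e x - sZ (decide (e x % 4 = 3))) / 4 = k := by
        rw [show e x - sZ (decide (e x % 4 = 3)) = 4 * k from hk]; simp
      rw [hk', Int.odd_iff]
      by_contra hne
      apply hx8
      show (8 : ℤ) ∣ e x - sZ (decide (e x % 4 = 3))
      rw [show e x - sZ (decide (e x % 4 = 3)) = 4 * k from hk]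
      exact ⟨k / 2, by omega⟩
    exact tzc_pw_L hσ ⟨k, hk⟩ hkodd
  have hLsum : 8 * (#L : ℤ) ≤ ∑ x ∈ P, (e x ^ 2 - 1) := by
    have h1 : ∑ x ∈ L, (e x ^ 2 - 1) ≤ ∑ x ∈ P, (e x ^ 2 - 1) := sum_le_sum_of_subset_of_nonneg hLsub fun x hx _ => hPnn x hx
    have h2 := sum_le_sum hLcost
    rw [sum_const, nsmul_eq_mul] at h2
    linarith
  have hbud' : ∑ x ∈ P, (e x ^ 2 - 1) + ∑ y ∈ P', e y ^ 2 ≤ 1535 := hbud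
  have : 8 * (#L : ℤ) ≤ 511 := by linarith
  have : (#L : ℤ) ≤ 63 := by omega
  exact_mod_cast this

/-! ### Clean parallel translates off `P` -/

/-- **Zero value.**  A point of the complement `c ⊕ V` of `P` that is neither in `A₂ = c ⊕ V₁` nor a stray point has `e = 0`. [this work] -/
theorem tzi_zero_value (f : (Fin (6 + 6) → Bool) → Bool) (u' : (Fin (6 + 6) → Bool) → ℤ)
    (V : Finset (Fin (6 + 6) → Bool)) (c : Fin (6 + 6) → Bool) (V₁ : Finset (Fin (6 + 6) → Bool))
    (hPc : (univ.filter fun x : Fin (6 + 6) → Bool => ¬ Odd (u' x)) = V.image (bxor c))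
    (hA2 : (univ.filter fun y : Fin (6 + 6) → Bool => ¬ Odd (u' y) ∧ ¬ (4 : ℤ) ∣ u' y - 2 * sZ (f y)) = V₁.image (bxor c))
    {y : Fin (6 + 6) → Bool} (hy : y ∈ V.image (bxor c)) (hyA : y ∉ V₁.image (bxor c))
    (hyS : y ∉ univ.filter fun y : Fin (6 + 6) → Bool =>
        ¬ Odd (u' y) ∧ (4 : ℤ) ∣ u' y - 2 * sZ (f y) ∧ u' y - 2 * sZ (f y) ≠ 0) :
    u' y - 2 * sZ (f y) = 0 := by
  rw [← hPc] at hy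
  have hev : ¬ Odd (u' y) := (mem_filter.1 hy).2
  rw [← hA2] at hyA
  have h4 : (4 : ℤ) ∣ u' y - 2 * sZ (f y) := by
    by_contra h4; exact hyA (mem_filter.2 ⟨mem_univ _, hev, h4⟩)
  by_contra hne
  exact hyS (mem_filter.2 ⟨mem_univ _, hev, h4, hne⟩)

/-- **(H4) for frames with two `V₁`-directions.**  On the window in case α: for `x ∈ P`, `t₁, t₂ ∈ V`, `w₁, w₂ ∈ V₁`,
`8 ∣ Σ_{ε ∈ 𝔽₂⁴} e(x ⊕ ε·(t₁, t₂, w₁, w₂))`.  Finite-slice statement, NOT summit progress. [this work] -/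
theorem tzi_H4w (f g : (Fin (6 + 6) → Bool) → Bool) (hf : IsDegLeFun 3 f) (hg : IsDegLeFun 3 g)
    (u' : (Fin (6 + 6) → Bool) → ℤ) (hu' : ∀ x, W (fun y => signOf (g y)) x = (2 : ℝ) ^ 5 * (u' x : ℝ))
    (V : Finset (Fin (6 + 6) → Bool)) (h0 : zeroVec ∈ V) (hadd : ∀ a ∈ V, ∀ b ∈ V, bxor a b ∈ V)
    (hcardV : #V = 2048) (c : Fin (6 + 6) → Bool) (V₁ : Finset (Fin (6 + 6) → Bool)) (hsub : V₁ ⊆ V) (h10 : zeroVec ∈ V₁)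
    (h1add : ∀ a ∈ V₁, ∀ b ∈ V₁, bxor a b ∈ V₁) (h1card : #V₁ = 256)
    (hPc : (univ.filter fun x : Fin (6 + 6) → Bool => ¬ Odd (u' x)) = V.image (bxor c))
    (hA2 : (univ.filter fun y : Fin (6 + 6) → Bool => ¬ Odd (u' y) ∧ ¬ (4 : ℤ) ∣ u' y - 2 * sZ (f y)) = V₁.image (bxor c))
    (hbud : ∑ x ∈ univ.filter (fun x : Fin (6 + 6) → Bool => Odd (u' x)), ((u' x - 2 * sZ (f x)) ^ 2 - 1) +
        ∑ y ∈ univ.filter (fun y : Fin (6 + 6) → Bool => ¬ Odd (u' y)), (u' y - 2 * sZ (f y)) ^ 2 ≤ 1535)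
    (x : Fin (6 + 6) → Bool) {t₁ t₂ w₁ w₂ : Fin (6 + 6) → Bool}
    (ht₁ : t₁ ∈ V) (ht₂ : t₂ ∈ V) (hw₁ : w₁ ∈ V₁) (hw₂ : w₂ ∈ V₁) :
    (8 : ℤ) ∣ ∑ ε : Fin 4 → Bool, (u' (fun j => x j ^^ decide (Odd #(univ.filter fun i =>
        ε i && (![t₁, t₂, w₁, w₂] : Fin 4 → Fin (6 + 6) → Bool) i j))) -
      2 * sZ (f (fun j => x j ^^ decide (Odd #(univ.filter fun i =>
        ε i && (![t₁, t₂, w₁, w₂] : Fin 4 → Fin (6 + 6) → Bool) i j))))) := by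
  classical
  set e : (Fin (6 + 6) → Bool) → ℤ := fun x => u' x - 2 * sZ (f x) with hedef
  set A₂ := V₁.image (bxor c) with hA₂def
  set H₀ := V.image (bxor c) with hH₀def
  set SR := univ.filter (fun y : Fin (6 + 6) → Bool => ¬ Odd (u' y) ∧ (4 : ℤ) ∣ e y ∧ e y ≠ 0) with hSRdef
  have hSR : #SR ≤ 31 := tzb_SR_card f u' c V₁ h1card hA2 hbud
  have hA2card : #A₂ = 256 := by rw [hA₂def, card_image_of_injective _ (iw_bxor_injective c), h1card]
  have hH₀card : #H₀ = 2048 := by rw [hH₀def, card_image_of_injective _ (iw_bxor_injective c), hcardV]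
  -- the `t`-part, the `w`-part and the full direction of a flat point
  set τ : (Fin 4 → Bool) → (Fin (6 + 6) → Bool) := fun ε => fun j => (ε 0 && t₁ j) ^^ (ε 1 && t₂ j) with hτ
  set ω : (Fin 4 → Bool) → (Fin (6 + 6) → Bool) := fun ε => fun j => (ε 2 && w₁ j) ^^ (ε 3 && w₂ j) with hω
  have hτV : ∀ ε, τ ε ∈ V := fun ε => tzi_pair_mem V h0 hadd ht₁ ht₂ (ε 0) (ε 1)
  have hωV₁ : ∀ ε, ω ε ∈ V₁ := fun ε => tzi_pair_mem V₁ h10 h1add hw₁ hw₂ (ε 2) (ε 3)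
  have hpt : ∀ (z : Fin (6 + 6) → Bool) (ε : Fin 4 → Bool),
      (fun j => z j ^^ decide (Odd #(univ.filter fun i => ε i && (![t₁, t₂, w₁, w₂] : Fin 4 → Fin (6 + 6) → Bool) i j))) =
        bxor (bxor z (τ ε)) (ω ε) := fun z ε => tzi_flatPt4 z t₁ t₂ w₁ w₂ ε
  -- forbidden base points off `P`
  set BADA := (A₂ ∪ A₂.image (fun a => bxor a t₁)) ∪ (A₂.image (fun a => bxor a t₂) ∪ A₂.image (fun a => bxor a (bxor t₁ t₂)))
    with hBADAdef
  set BADS := (univ : Finset (Fin 4 → Bool)).biUnion (fun ε => SR.image (fun s => bxor s (bxor (τ ε) (ω ε)))) with hBADSdef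
  have hBADAcard : #BADA ≤ 1024 := by
    have hu : #BADA ≤ (#A₂ + #A₂) + (#A₂ + #A₂) := by
      refine (card_union_le _ _).trans (Nat.add_le_add ?_ ?_)
      · exact (card_union_le _ _).trans (Nat.add_le_add_left card_image_le _)
      · exact (card_union_le _ _).trans (Nat.add_le_add card_image_le card_image_le)
    omega
  have hBADScard : #BADS ≤ 496 := by
    have hu : #BADS ≤ ∑ _ε : Fin 4 → Bool, #SR := by
      refine card_biUnion_le.trans (sum_le_sum fun ε _ => card_image_le)
    rw [sum_const, card_univ, Fintype.card_fun, Fintype.card_bool, Fintype.card_fin, smul_eq_mul] at hu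
    omega
  have hBADcard : #(BADA ∪ BADS) < #H₀ := by
    have := card_union_le BADA BADS
    omega
  obtain ⟨z, hzH, hzB⟩ : ∃ z, z ∈ H₀ ∧ z ∉ BADA ∪ BADS := exists_mem_notMem_of_card_lt_card hBADcard
  rw [mem_union, not_or] at hzB
  obtain ⟨hzA, hzS⟩ := hzB
  -- every point of the parallel translate through `z` has `e = 0`
  have hzero : ∀ ε : Fin 4 → Bool, e (bxor (bxor z (τ ε)) (ω ε)) = 0 := by
    intro ε
    refine tzi_zero_value f u' V c V₁ hPc hA2 ?_ ?_ ?_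
    · exact fl1_coset_vadd hadd rfl (fl1_coset_vadd hadd rfl hzH (hτV ε)) (hsub (hωV₁ ε))
    · intro hmem
      have hmem' : bxor z (τ ε) ∈ A₂ := by
        have := fl1_coset_vadd h1add rfl hmem (hωV₁ ε)
        rwa [iw_bxor_assoc, bxor_self, bxor_zeroVec] at this
      apply hzA
      have hz' : z = bxor (bxor z (τ ε)) (τ ε) := by rw [iw_bxor_assoc, bxor_self, bxor_zeroVec]
      rcases tzi_tpart_cases t₁ t₂ ε with h | h | h | h <;> have h' : τ ε = _ := h <;> rw [h'] at hz' hmem'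
      · have : z ∈ A₂ := by rw [bxor_zeroVec] at hmem'; exact hmem'
        exact mem_union_left _ (mem_union_left _ this)
      · have : z ∈ A₂.image (fun a => bxor a t₁) := mem_image.2 ⟨_, hmem', hz'.symm⟩
        exact mem_union_left _ (mem_union_right _ this)
      · have : z ∈ A₂.image (fun a => bxor a t₂) := mem_image.2 ⟨_, hmem', hz'.symm⟩
        exact mem_union_right _ (mem_union_left _ this)
      · have : z ∈ A₂.image (fun a => bxor a (bxor t₁ t₂)) := mem_image.2 ⟨_, hmem', hz'.symm⟩
        exact mem_union_right _ (mem_union_right _ this)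
    · intro hmem
      apply hzS
      rw [mem_biUnion]
      refine ⟨ε, mem_univ _, mem_image.2 ⟨_, hmem, ?_⟩⟩
      show bxor (bxor (bxor z (τ ε)) (ω ε)) (bxor (τ ε) (ω ε)) = z
      rw [iw_bxor_assoc z, iw_bxor_assoc z, bxor_self, bxor_zeroVec]
  -- the 5-flat congruence through `x` and the translate through `z`
  have h8 := l5c_flat5 f g hf hg u' hu' x ![bxor x z, t₁, t₂, w₁, w₂]
  change (8 : ℤ) ∣ ∑ ε : Fin 5 → Bool, e (fun j => x j ^^ decide (Odd #(univ.filter fun i =>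
      ε i && (![bxor x z, t₁, t₂, w₁, w₂] : Fin 5 → Fin (6 + 6) → Bool) i j))) at h8
  have e5 : (![bxor x z, t₁, t₂, w₁, w₂] : Fin 5 → Fin (6 + 6) → Bool) = Fin.cons (bxor x z) ![t₁, t₂, w₁, w₂] := rfl
  rw [e5, l5c_sum_split e x (bxor x z) ![t₁, t₂, w₁, w₂], bxor_bxor_cancel_left] at h8
  have hz0 : ∑ ε : Fin 4 → Bool, e (fun j => z j ^^ decide (Odd #(univ.filter fun i =>
      ε i && (![t₁, t₂, w₁, w₂] : Fin 4 → Fin (6 + 6) → Bool) i j))) = 0 :=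
    sum_eq_zero fun ε _ => by rw [hpt z ε]; exact hzero ε
  rw [hz0, add_zero] at h8
  exact h8

end Summit.QuantumAdvantage.QuantumAdvantage.Theorems.CubicForrelation.NearExactIsExact

end
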